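import Summits.Ventures.PercRepro.S1CircuitProfile

/-!
# PercRepro — THE CIRCUIT-SUMMAND CONSUMER, THE PARTS SHARED BY EVERY CELL `(p, 4)` (p2, gen 28;
SUBCLAIM-S1 §6.10 (xvii))

Three facts used by every consumer `(p, 4)` with a circuit summand, stated once with `p = r + s` symbolic:

* **`ncard_U_disjointSum_circuit_le`** — `#U(M ⊕ N; p, 4) ≤ N_M(r, 4) + (s + 1) · N_M(r, 3)` for `M` of rank `r`
  and `N` a circuit of `s + 1 ≥ 3` elements (rank `s`), `r + s = p`: of the convolution
  `S1DisjointSumU.disjointSum_ncard_U_eq_finsum` only the slices `(r, 4)` and `(r, 3)` survive (above rank `r`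
  the `M`-profile is empty, below it the `N`-profile is, and a rank-`s` set of a circuit has a complement of
  rank `≤ 1`), and the circuit's entries are `N_N(s, 0) ≤ 1`, `N_N(s, 1) ≤ s + 1`;
* **`ncard_profileSet_add_le_ncard_rankSet`** — `N_M(r, 4) + N_M(r, 3) ≤ f_M(r)` (disjoint subsets of the rank
  level);
* **`ncard_profileSet_le_ncard_rankSet_snd`** — `N_M(a, b) ≤ f_M(b)` (complementation is an injection);
* `rankSet_disjoint_of_ne`, `ySet_eq_rankSet_of_eq`, `ySet_eq_rankSet_union_of_eq` — the `Y`-sets of the cells `(q + 2, q)` and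
  `(q + 3, q)` are the rank levels `q + 1`, resp. `q + 1` and `q + 2`.
Nothing is claimed about any cell.
-/

open scoped Matroid

namespace PercRepro

namespace S1

open Set

variable {α : Type}

/-- **The `U`-side of every circuit-summand consumer**: for `M` of rank `r` and `N` a circuit of `s + 1 ≥ 3`
elements with `r + s = p`, `#U(M ⊕ N; p, 4) ≤ N_M(r, 4) + (s + 1) · N_M(r, 3)`. -/
theorem ncard_U_disjointSum_circuit_le (M N : Matroid α) [M.Finite] [N.Finite] (h : Disjoint M.E N.E)
    {p r s : ℕ} (hrs : r + s = p) (hs : 2 ≤ s) (hM : M.eRank = r) (hN : N.IsCircuit N.E)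
    (hNs : N.E.ncard = s + 1) :
    {A : Set α | A ⊆ (M.disjointSum N h).E ∧ (M.disjointSum N h).eRk A = (p : ℕ∞) ∧
        (M.disjointSum N h).eRk ((M.disjointSum N h).E \ A) = ((4 : ℕ) : ℕ∞)}.ncard ≤
      (profileSet M r 4).ncard + (s + 1) * (profileSet M r 3).ncard := by
  have hNr : N.eRank = ((s : ℕ) : ℕ∞) := eRank_eq_of_isCircuit_ground hN hNs
  rw [disjointSum_ncard_U_eq_finsum M N h p 4, finsum_mem_coe_finset]
  rw [Finset.sum_eq_add_of_mem (r, 4) (r, 3)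
    (by simp only [Finset.mem_product, Finset.mem_range]; omega)
    (by simp only [Finset.mem_product, Finset.mem_range]; omega)
    (by simp only [ne_eq, Prod.mk.injEq]; norm_num) ?_]
  · dsimp only
    rw [show p - r = s by omega, show (4 : ℕ) - 4 = 0 from rfl, show (4 : ℕ) - 3 = 1 from rfl]
    have h0 := ncard_profileSet_top_zero_le hN hNs (by omega)
    have h1 := ncard_profileSet_top_one_le hN hNs
    calc (profileSet M r 4).ncard * (profileSet N s 0).ncard +
          (profileSet M r 3).ncard * (profileSet N s 1).ncard
        ≤ (profileSet M r 4).ncard * 1 + (profileSet M r 3).ncard * (s + 1) :=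
          Nat.add_le_add (Nat.mul_le_mul_left _ h0) (Nat.mul_le_mul_left _ h1)
      _ = (profileSet M r 4).ncard + (s + 1) * (profileSet M r 3).ncard := by ring
  · rintro ⟨a, b⟩ hmem ⟨hne1, hne2⟩
    rw [Finset.mem_product, Finset.mem_range, Finset.mem_range] at hmem
    dsimp only
    rcases Nat.lt_or_ge r a with ha | ha
    · rw [profileSet_eq_empty_of_eRank_lt M hM ha b, ncard_empty, zero_mul]
    rcases Nat.lt_or_ge a r with ha' | ha'
    · rw [profileSet_eq_empty_of_eRank_lt N hNr (by omega) (4 - b), ncard_empty, mul_zero]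
    have har : a = r := by omega
    subst har
    have hb : b ≤ 2 := by
      rcases Nat.lt_or_ge b 3 with hb | hb
      · omega
      · exfalso
        rcases Nat.lt_or_ge b 4 with hb4 | hb4
        · exact hne2 (by congr 1; omega)
        · exact hne1 (by congr 1; omega)
    rw [show p - a = s by omega, profileSet_top_eq_empty_of_two_le hN hNs (by omega), ncard_empty,
      mul_zero]

/-- Two profile sets at the same rank with different complement ranks are disjoint. -/
theorem profileSet_disjoint_snd (M : Matroid α) (a : ℕ) {b b' : ℕ} (hbb : b ≠ b') :
    Disjoint (profileSet M a b) (profileSet M a b') := by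
  rw [Set.disjoint_left]
  rintro A ⟨-, -, hb⟩ ⟨-, -, hb'⟩
  apply hbb
  have h := hb.symm.trans hb'
  exact_mod_cast h

/-- `N_M(a, b) + N_M(a, b') ≤ f_M(a)` for `b ≠ b'`. -/
theorem ncard_profileSet_add_le_ncard_rankSet (M : Matroid α) [M.Finite] (a : ℕ) {b b' : ℕ} (hbb : b ≠ b') :
    (profileSet M a b).ncard + (profileSet M a b').ncard ≤ (rankSet M a).ncard := by
  rw [← ncard_union_eq (profileSet_disjoint_snd M a hbb)
    ((rankSet_finite M a).subset (profileSet_subset_rankSet M a b))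
    ((rankSet_finite M a).subset (profileSet_subset_rankSet M a b'))]
  exact ncard_le_ncard (union_subset (profileSet_subset_rankSet M a b) (profileSet_subset_rankSet M a b'))
    (rankSet_finite M a)

/-- **Complementation**: `N_M(a, b) ≤ f_M(b)` — `A ↦ E ∖ A` is an injection of the profile set into the rank
level of the complements. -/
theorem ncard_profileSet_le_ncard_rankSet_snd (M : Matroid α) [M.Finite] (a b : ℕ) :
    (profileSet M a b).ncard ≤ (rankSet M b).ncard := by
  refine ncard_le_ncard_of_injOn (fun A => M.E \ A) ?_ ?_ (rankSet_finite M b)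
  · rintro A ⟨-, -, hAc⟩
    exact ⟨sdiff_subset, hAc⟩
  · rintro A ⟨hAE, -, -⟩ B ⟨hBE, -, -⟩ hAB
    have hAB' : M.E \ A = M.E \ B := hAB
    rw [← sdiff_sdiff_cancel_left hAE, ← sdiff_sdiff_cancel_left hBE, hAB']

/-- Rank-level sets at different levels are disjoint. -/
theorem rankSet_disjoint_of_ne (M : Matroid α) {a b : ℕ} (hab : a ≠ b) :
    Disjoint (rankSet M a) (rankSet M b) := by
  rw [Set.disjoint_left]
  rintro A ⟨-, ha⟩ ⟨-, hb⟩
  apply hab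
  have h := ha.symm.trans hb
  exact_mod_cast h

/-- The `Y`-set of a cell `(q + 2, q)` is the rank level `q + 1`. -/
theorem ySet_eq_rankSet_of_eq (M : Matroid α) {q p k : ℕ} (hk : k = q + 1) (hp : p = q + 2) :
    {A : Set α | A ⊆ M.E ∧ (q : ℕ∞) < M.eRk A ∧ M.eRk A < (p : ℕ∞)} = rankSet M k := by
  ext A
  simp only [mem_setOf_eq, rankSet]
  constructor
  · rintro ⟨hAE, h1, h2⟩
    refine ⟨hAE, ?_⟩
    obtain ⟨n, hn⟩ := ENat.ne_top_iff_exists.mp (ne_top_of_lt h2)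
    rw [← hn] at h1 h2 ⊢
    have h1' : q < n := by exact_mod_cast h1
    have h2' : n < p := by exact_mod_cast h2
    have h3 : n = k := by omega
    rw [h3]
  · rintro ⟨hAE, hA⟩
    refine ⟨hAE, ?_⟩
    rw [hA]
    constructor
    · exact_mod_cast (show q < k by omega)
    · exact_mod_cast (show k < p by omega)

/-- The `Y`-set of a cell `(q + 3, q)` is the union of the rank levels `q + 1` and `q + 2`. -/
theorem ySet_eq_rankSet_union_of_eq (M : Matroid α) {q p k k' : ℕ} (hk : k = q + 1) (hk' : k' = q + 2)
    (hp : p = q + 3) :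
    {A : Set α | A ⊆ M.E ∧ (q : ℕ∞) < M.eRk A ∧ M.eRk A < (p : ℕ∞)} = rankSet M k ∪ rankSet M k' := by
  ext A
  simp only [mem_setOf_eq, rankSet, mem_union]
  constructor
  · rintro ⟨hAE, h1, h2⟩
    obtain ⟨n, hn⟩ := ENat.ne_top_iff_exists.mp (ne_top_of_lt h2)
    rw [← hn] at h1 h2 ⊢
    have h1' : q < n := by exact_mod_cast h1
    have h2' : n < p := by exact_mod_cast h2
    rcases Nat.lt_or_ge n k' with h5 | h5
    · left
      refine ⟨hAE, ?_⟩
      have h3 : n = k := by omega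
      rw [h3]
    · right
      refine ⟨hAE, ?_⟩
      have h3 : n = k' := by omega
      rw [h3]
  · rintro (⟨hAE, hA⟩ | ⟨hAE, hA⟩)
    · refine ⟨hAE, ?_⟩
      rw [hA]
      constructor
      · exact_mod_cast (show q < k by omega)
      · exact_mod_cast (show k < p by omega)
    · refine ⟨hAE, ?_⟩
      rw [hA]
      constructor
      · exact_mod_cast (show q < k' by omega)
      · exact_mod_cast (show k' < p by omega)

/-- `Φ(8, 4) = 76/15`. -/
theorem phiK_eight_four : phiK 8 4 = 76 / 15 := by
  unfold phiK
  rw [show Finset.Ioo 4 8 = {5, 6, 7} from by decide, show (8 : ℕ) + 4 = 12 from rfl]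
  rw [Finset.sum_insert (by decide), Finset.sum_insert (by decide), Finset.sum_singleton]
  rw [show Nat.choose 12 5 = 792 by decide, show Nat.choose 12 6 = 924 by decide,
    show Nat.choose 12 7 = 792 by decide, show Nat.choose 12 8 = 495 by decide]
  norm_num

end S1

end PercRepro
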